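import Summits.AtomisticToContinuum.HydrodynamicLimit.Theses.RelayRaceLocality
import Summits.AtomisticToContinuum.HydrodynamicLimit.Theorems.RelayRaceLocalityLightConeInLawSketchLine
import Summits.AtomisticToContinuum.HydrodynamicLimit.Theorems.RelayRaceLocalityLightConeInLawStubProfileId
import Summits.AtomisticToContinuum.HydrodynamicLimit.Theorems.RelayRaceLocalityLightConeInLawSVCLine
import Summits.AtomisticToContinuum.HydrodynamicLimit.Theorems.RelayRaceLocalityLightConeInLawStubSusceptibility
import Summits.AtomisticToContinuum.HydrodynamicLimit.Theorems.RelayRaceLocalityLightConeInLawStubCountIVT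
import Summits.AtomisticToContinuum.HydrodynamicLimit.Theorems.RelayRaceLocalityLightConeInLawStubCountLCLT
import Summits.AtomisticToContinuum.HydrodynamicLimit.Theorems.RelayRaceLocalityLightConeInLawStubChain
import Summits.AtomisticToContinuum.HydrodynamicLimit.Theorems.RelayRaceLocalityLightConeInLawSVCVarReduction
import Summits.AtomisticToContinuum.HydrodynamicLimit.Theorems.RelayRaceLocalityLightConeInLawConeGlobal
import Summits.AtomisticToContinuum.HydrodynamicLimit.Theorems.RelayRaceLocalityNearConstantShortTimeHLStaticLLN
import Summits.AtomisticToContinuum.HydrodynamicLimit.Theorems.RelayRaceLocalityNearConstantShortTimeHLGeneralGibbs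
import Summits.AtomisticToContinuum.HydrodynamicLimit.Theorems.RelayRaceLocalityNearConstantShortTimeHLGeneralFamilyFreeEnergy
import Summits.AtomisticToContinuum.HydrodynamicLimit.Theorems.LightConeInLaw.Negative.HomogeneousWitness
import Literature.Analysis.FluidPDE.HardSphereAlexander
import Literature.MathematicalPhysics.KineticTheory.HardSphereCanonicalTorus
import HarnessLib

/-!
# Line `susceptibility-variance-continuity` for the crux `LightConeInLaw` (stmt-AtomisticToContinuum-12500)

Route `RelayRaceLocality`, crux rank 2 (`…Theses.RelayRaceLocality.LightConeInLaw`, the TWO-COPY LIGHT CONE IN LAW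
for the hard-sphere gas at fixed reduced density). Crux-plan of the crux idea
`Cruxes/LightConeInLaw/Ideas/susceptibility-variance-continuity.md` (ideator 1, round 1; triage r1: pass ×3, with the
sharpenings "rescale the activity — the typed `gcWeight` family was centred at O(1) particles and vacuous",
"the ONE dynamic stub is CLT-rate variance of the time-`t` fields under a one-parameter family of INITIAL laws",
"it is needed only for centre offsets ≫ √N; below that the commensurate restatement R2 carries the locality").

## The line (five registered stubs, composition `LightConeInLaw_of` kernel-checked)

The crux as filed quantifies over EVERY comparison particle number `n₂ N` with `n₂ N · ε_N³ → σ₂³`; it therefore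
contains (tree, `Necessary.particleNumberContinuity_of_lightConeInLaw`, p103773) PARTICLE-NUMBER CONTINUITY, a
first-moment law-stability statement with no locality content, on top of its locality content. This line FACTORS
the crux at exactly that seam and supplies the particle-number part by the card's susceptibility mechanism:

* `stub_cone` — (R2 of the dead line's restatement menu, VERBATIM `Restatements.LightConeInLawCommensurate`) the
  crux with the comparison number PINNED to the commensurate family `n₂ N = ⌈(σ₂/σ₁)³ (N+1)⌉₊`. NECESSARY
  (`cone_of_lightConeInLaw : LightConeInLaw → stub_cone` below, = `commensurate_of_lightConeInLaw`), strictly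
  weaker than the crux (no `o(N)` slack, hence no particle-number continuity), and what the consumer
  `ConeLocalisation` (stmt-12504) actually uses. Its intended proof is the MERGED line of cards
  `count-sufficiency-reduction` / `demix-not-couple` (DLR conditioning + two-run exterior screening K1 ≡ S1 +
  static contiguity K2 + Le Cam + rate-free one-gas concentration K3): XL, the route's engine; not this card's.
* `stub_var` — the card's ONE DYNAMIC INPUT `GCVarianceBound` (its Transfer C⁺): along the POISSONISED canonical
  family of gas 2 (mixture `p_μ(n) ∝ μⁿ Z_{N,n}/n!` of the canonical laws of `n` spheres, same diameter
  `hsDiameter σ₁ N`, same profile `(a₂,u₂,θ₂)`), for every activity `μ` whose MEAN COUNT lies within a factor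
  `1 ± κ` of the commensurate centre `(σ₂/σ₁)³(N+1)` (this is the triage's rescaling: the family is centred at
  `≍ N` spheres, not at `O(1)`), the mixture variances of the five reduced time-`t` field statistics are
  `≤ C/(N+1)`. One law, second moment, an identity at global equilibrium (stationarity), MD-falsifiable.
* `stub_countCLT` — STATICS of the same Poissonised family (low-activity cluster expansion / local CLT for the
  particle number of the hard-sphere gas, in print, unformalised): every centre in the window is attained by some
  activity; the count variance is `≍ N+1` (two-sided); the weight at the centre is `≥ c₀/√(N+1)`.
* `stub_susceptibility` — the card's LEVER as an abstract, provable-now calculus lemma: for an exponential family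
  of weights `p_ν(n) ∝ wₙ νⁿ` on `ℕ` and a polynomially bounded `g`, `d/dν Σ p_ν g = ν⁻¹ Cov_{p_ν}(n, g)`.
* `stub_chain` — ANALYSIS (no dynamics): `stub_var → stub_countCLT → stub_susceptibility → ParticleNumberMerging`,
  where `ParticleNumberMerging` (PNM) is particle-number continuity for the comparison family: two commensurate
  number sequences `n, n'` of the SAME profile gas give merging laws of `F`(reduced fields at `t`). Proof sketch:
  Lipschitz reduction of `F` to the five field statistics, law of total variance `Var_p(g) ≤ Var_mix(F) ≤ 5C/(N+1)`,
  pointwise extraction at the centre via `p ≥ c₀/√(N+1)`, and the susceptibility bound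
  `|d ḡ/d log ν| ≤ SD(n)·SD(g) = O(1)` integrated over `|Δ log ν| ≤ |n − n'|/(s₀(N+1)) → 0`.
* `LightConeInLaw_of` (sorry-free): given the crux's data with a general `n₂`, apply `stub_cone` to the
  commensurate gas `n₂* = ⌈(σ₂/σ₁)³(N+1)⌉₊` (flows from Alexander's theorem `HardSphereFlow.nonempty_torus_holds`,
  normalisation from `posPartition_pos` + `posPartition_antitone_diam`, the `t = 0` tie transferred from the
  `n₂`-gas by the tree's PROVED static law of large numbers `NearConstantShortTimeHL.staticLLN_explicit` and
  uniqueness of limits in probability) and PNM between `n₂*` and `n₂`; add.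

Hardest stub: `stub_cone` (XL, the light cone proper). The card's own load-bearing stub: `stub_var` (open for every
deterministic gas; "determinism half of the hydrodynamic limit at CLT rate, without identification").

## Disproof used (`Cruxes/LightConeInLaw/Disproof.lean`, cdisprove cycle 1, sorry-free; read 2026-08-16T19:05Z)
No kill, no `-- Targets` section. §2/§2b (`lightConeInLaw_false_without_thermalAgreement / _velocityAgreement /
_support / _tieOne / _tieTwo`, landed `Theorems/LightConeInLaw/Negative/HomogeneousWitness.lean`, imported here):
ALL five clauses are kept verbatim in `stub_cone` and consumed by `LightConeInLaw_of`; PNM compares two gases with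
the SAME profile and the SAME Euler data, so the homogeneous two-state witness (different energy densities) is not
an instance of it. §5 (`lightConeInLaw_false_without_positiveDiameter`, `Negative/IdealGas*.lean`): every stub
keeps `0 < σ₁, 0 < σ₂`; `stub_cone` is false for free streaming as it must be (its proof must use collisions),
while PNM and `stub_var` are TRUE for the ideal gas (independent particles) — consistent: the locality lives in
`stub_cone` only. §1 (`R ≥ 1 ⇒ σ₁ = σ₂`, crux collapses to PNC): exactly the seam this line cuts along.

## Rev 2 (line lead a1, prover-line-stmt-AtomisticToContinuum-12500-a1-0, 2026-08-16) — RESHAPED, same composition idea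

* The vocabulary (`wZ`, `wP`, `wMean`, `canonicalWeights`, `countWeight`, `meanCount`, `varCount`, `canonicalMean`,
  `mixtureMean`, `mixtureVariance`, `wZ_canonicalWeights`) now lives in the IMPORTABLE support file
  `Theorems/RelayRaceLocalityLightConeInLawSVCLine.lean` (namespace `…Theorems.LightConeInLawSVC`, opened below), so that every
  stub can land under `Theorems/` with its registered signature verbatim; the local copies are deleted (byte-identical bodies).
* `stub_var` is WEAKENED to the form the chain actually consumes (law of total variance already applied): the Poissonised
  variance of the CONDITIONAL EXPECTATION GIVEN THE PARTICLE NUMBER, `Var_{p_μ}(k ↦ E_{π_{N,k}} F(fields_t))  ≤ C/(N+1)` for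
  every bounded 1-Lipschitz `F`, eventually in `N`, on the mean-count window. It is implied by rev 1's `GCVarianceBound`
  (mixture variance of the five field statistics) via `Var(E[X|K]) ≤ Var X` + Lipschitz, carries the same physics
  (`√N`-window insensitivity of canonical time-`t` expectations at CLT rate), is still one-gas / second-moment / true for the
  ideal gas, and removes all integrability side conditions from the chain.
* `stub_countCLT` is SPLIT into `stub_countIVT` (part (a): every centre of the window is a mean count — provable now: the mean
  count is continuous and monotone in the activity, `→ 0` at `μ → 0⁺`, and exceeds the window for large `μ` because
  `Z_{N,n} > 0` up to `n ≍ (N+1)/(8σ₁³)`) and `stub_countLCLT` (parts (b) two-sided linear count variance and (c) local lower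
  bound `p ≥ c₀/√(N+1)` at the mean — cluster-expansion statics, L).
* `stub_chain` states its four hypotheses INLINE (the statements of `stub_var`, `stub_countIVT`, `stub_countLCLT`,
  `stub_susceptibility`, byte-identical), so that its registered signature is reproducible in a Theorems file; it is now pure
  discrete analysis on exponential families of weights on `ℕ` plus `|E_{π} F| ≤ 1`.
* `stub_cone`, `stub_susceptibility`: unchanged. Composition `LightConeInLaw_of` re-checked (6 stubs ≤ stubs_max 7).

## Status after wave 1 (lead a1, 2026-08-16T21:10Z) — 2 open stubs: `stub_cone`, `stub_var`

LANDED (all `--supports stmt-AtomisticToContinuum-12500`, ACCEPTED): vocabulary `…SVCLine.lean` p122841 ·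
`stub_susceptibility` p123631 (`…StubSusceptibility.lean`) · `stub_countIVT` p123767 (`…StubCountIVT.lean`) ·
`stub_countLCLT` p126108 (`…StubCountLCLT.lean`, with helpers p124109 RatioLipschitz, p124381 CountFamilyMoments,
p124795 CountFamilyVariance, p125195 CountFamilyEnvelope, p125512 CountFamilyLCLT, p125185 CountWeightFamily — the
local CLT statics of the Poissonised count law PROVED from the tree's canonical insertion-ratio machinery) · `stub_chain`
p124174 (`…StubChain.lean`, abstract chain lemma) · rung `cone_global_of_cover` p124132 (`…ConeGlobal.lean`: `stub_cone`
with `1 ≤ R` — ball covers the torus ⇒ σ₁ = σ₂, n₂* = N+1, activity gauge, flow a.e.-uniqueness `flow_eq_ae_holds`) ·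
`stub_var` audit + reduction p124118 (`…SVCVarReduction.lean`: rev 1 ⟹ rev 2, `wVar_canonicalMean_le_of_msq`).
The four landed stubs are discharged below BY NAME (`Holds.stub_* := <landed theorem>`); the glue `pnm_of_stubs`
(C⁺ ⟹ particle-number merging) is sorry-free. OPEN: `stub_cone` (lead; XL — the light cone proper, local regime
`R < 1`) and `stub_var` (worker verdict `stub-blocked: PoissonisedFieldMSq` — CLT-rate Poissonised mean-square
concentration of the time-`t` reduced fields, OPEN at `t > 0` for every deterministic interacting gas; its `t = 0`
slice `StaticFieldMSq` is cluster-expansion statics in print, not in tree; both typed with kernel-checked reductions in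
the lead's folder `work/stubs/Var_missing_fact.lean`, attached as item evidence). So, kernel-checked:
`LightConeInLaw ⇐ stub_cone ∧ stub_var`.
-/

namespace Summit.AtomisticToContinuum.HydrodynamicLimit.Cruxes.LightConeInLaw.SusceptibilityVarianceContinuity

open scoped BigOperators Topology Classical ENNReal
open Filter Set MeasureTheory
open Literature.MathematicalPhysics.KineticTheory Literature.Analysis.FluidPDE
  Literature.Analysis.FunctionSpaces
open Summit.AtomisticToContinuum.HydrodynamicLimit.Theorems
open Summit.AtomisticToContinuum.HydrodynamicLimit.Theorems.LightConeInLawSketch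
open Summit.AtomisticToContinuum.HydrodynamicLimit.Theorems.LightConeInLawSVC

noncomputable section

/-! ## Vocabulary
Imported from `Theorems/RelayRaceLocalityLightConeInLawSVCLine.lean` (namespace `LightConeInLawSVC`,
opened above): `wZ`, `wP`, `wMean`, `canonicalWeights`, `countWeight`, `meanCount`, `varCount`, `canonicalMean`,
`mixtureMean`, `mixtureVariance`, `wZ_canonicalWeights`. -/

/-! ## Registered stubs (`Holds.stub_*`, bodies `sorry`) -/

namespace Holds

/-- STUB `stub_cone` (kind: locality; size XL; the hardest stub). **COMMENSURATE TWO-COPY LIGHT CONE IN LAW**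
— restatement R2 of the dead line `Sketch` (`Lines/SketchRestatements.lean`, `LightConeInLawCommensurate`,
verbatim): the crux with the comparison particle number PINNED to `n₂ N = ⌈(σ₂/σ₁)³ (N+1)⌉₊`. Necessary for the
crux (`cone_of_lightConeInLaw` below). Why plausibly true: it is the physical light cone (finite signal speed of the
dilute hard-sphere gas, relay chains measured in flight lengths; route card relay-race-light-cone) with the
particle-number slack removed — for tuned pairs the residual beyond the two-run cone K1 is static contiguity K2 of
the ball-count laws + Le Cam + rate-free one-gas concentration (triage r1-2 and r1-3 on card demix-not-couple). Why it
might fail / what it needs: the two-run exterior screening along the NON-equilibrium law over macroscopic times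
(route M1+M2; definition request D2 "two-run infected set"), above the open equilibrium rung `GibbsLightCone`
(stmt-12501). False for free streaming, as it must be (Disproof §5). Leans on: cards count-sufficiency-reduction,
demix-not-couple; `HardSphereFlow.backwardCluster`; Hofer-Temmel–Houdebert 2019, Last–Otto 2023 (static
disagreement couplings); MarchioroEtAl1978 / ButtaEtAl2007 (locality architecture). -/
theorem stub_cone :
    ∃ η₀ : ℝ, 0 < η₀ ∧ ∀ M : ℝ, 0 < M → ∃ c : ℝ, 0 < c ∧ ∀ (a₁ θ₁ a₂ θ₂ : T3 → ℝ) (u₁ u₂ : T3 → V3),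
    Continuous a₁ → Continuous θ₁ → Continuous u₁ → Continuous a₂ → Continuous θ₂ → Continuous u₂ →
    (∀ x, 0 < a₁ x) → (∀ x, 0 < θ₁ x) → (∀ x, 0 < a₂ x) → (∀ x, 0 < θ₂ x) → ∃ σ₀ : ℝ, 0 < σ₀ ∧ ∀
    (σ₁ σ₂ : ℝ), 0 < σ₁ → σ₁ < σ₀ → 0 < σ₂ → σ₂ < σ₀ → ∀ n₂ : ℕ → ℕ, (∀ N, n₂ N = ⌈(σ₂ / σ₁) ^ 3 *
    ((N + 1 : ℕ) : ℝ)⌉₊) → ∀ (T₁ T₂ : ℝ) (ρ₁ Θ₁ ρ₂ Θ₂ : ℝ → T3 → ℝ) (U₁ U₂ : ℝ → T3 → V3),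
    IsHardSphereEulerSolution σ₁ T₁ ρ₁ U₁ Θ₁ → IsHardSphereEulerSolution σ₂ T₂ ρ₂ U₂ Θ₂ → ∀ (Φ₁ :
    (N : ℕ) → HardSphereFlow (Torus.geometry (Fin 3)) (hsDiameter σ₁ N) (N + 1)) (Φ₂ : (N : ℕ) →
    HardSphereFlow (Torus.geometry (Fin 3)) (hsDiameter σ₁ N) (n₂ N)),
    let P₁ : (N : ℕ) → Measure (Config (N + 1) (Fin 3) T3) := fun N => localGibbsLaw σ₁ a₁ u₁ θ₁ N (Φ₁ N);
    let P₂ : (N : ℕ) → Measure (Config (n₂ N) (Fin 3) T3) := fun N => particleLaw (Φ₂ N) (canonicalDensity (Torus.geometry (Fin 3)) (hsDiameter σ₁ N) (n₂ N) (localGibbsProfile a₂ u₂ θ₂));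
    (∀ N, IsProbabilityMeasure (P₁ N)) → (∀ N, IsProbabilityMeasure (P₂ N)) → TendstoHydroFieldsAt
    P₁ Φ₁ ρ₁ U₁ Θ₁ 0 → (∀ χ : T3 → ℝ, Continuous χ → ∀ δ : ℝ, 0 < δ → Tendsto (fun N => P₂ N {z | δ
    < |empiricalDensityField ((Φ₂ N).flow 0 z) χ - ∫ x, χ x * ρ₂ 0 x|}) atTop (nhds 0) ∧ Tendsto
    (fun N => P₂ N {z | δ < ‖empiricalMomentumField ((Φ₂ N).flow 0 z) χ - ∫ x, (χ x * ρ₂ 0 x) • U₂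
    0 x‖}) atTop (nhds 0) ∧ Tendsto (fun N => P₂ N {z | δ < |empiricalEnergyField ((Φ₂ N).flow 0 z)
    χ - ∫ x, χ x * totalEnergyDensity (ρ₂ 0 x) (U₂ 0 x) (Θ₂ 0 x)|}) atTop (nhds 0)) → ∀ t : ℝ, 0 ≤
    t → t < T₁ → t < T₂ → (∀ s ∈ Set.Icc 0 t, ∀ x, ρ₁ s x * σ₁ ^ 3 < η₀ ∧ Θ₁ s x ≤ M ∧ ‖U₁ s x‖ ≤ M
    ∧ ρ₂ s x * σ₂ ^ 3 < η₀ ∧ Θ₂ s x ≤ M ∧ ‖U₂ s x‖ ≤ M) → ∀ (x₀ : T3) (R : ℝ), (∀ x,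
    Torus.euclidDist x x₀ < R → ρ₁ 0 x * σ₁ ^ 3 = ρ₂ 0 x * σ₂ ^ 3 ∧ U₁ 0 x = U₂ 0 x ∧ Θ₁ 0 x = Θ₂ 0
    x) → ∀ χ : T3 → ℝ, Continuous χ → (∀ x, R - c * t ≤ Torus.euclidDist x x₀ → χ x = 0) → ∀ F : ℝ
    × V3 × ℝ → ℝ, LipschitzWith 1 F → (∀ p, |F p| ≤ 1) → Tendsto (fun N => (∫ z, F (σ₁ ^ 3 *
    empiricalDensityField ((Φ₁ N).flow t z) χ, (σ₁ ^ 3) • empiricalMomentumField ((Φ₁ N).flow t z)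
    χ, σ₁ ^ 3 * empiricalEnergyField ((Φ₁ N).flow t z) χ) ∂(P₁ N)) - ∫ z, F (σ₂ ^ 3 *
    empiricalDensityField ((Φ₂ N).flow t z) χ, (σ₂ ^ 3) • empiricalMomentumField ((Φ₂ N).flow t z)
    χ, σ₂ ^ 3 * empiricalEnergyField ((Φ₂ N).flow t z) χ) ∂(P₂ N)) atTop (nhds 0) := by
  sorry

/-- STUB `stub_var` (kind: dynamic input; size XL / open; rev 2 = the weakest form the chain consumes).
**CLT-RATE VARIANCE OF THE COUNT-CONDITIONAL TIME-`t` EXPECTATIONS UNDER POISSONISED LOCAL GIBBS DATA.** For gas 2 of the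
crux (profile `(a₂,u₂,θ₂)`, diameter `hsDiameter σ₁ N`, Euler solution `(ρ₂,U₂,Θ₂)` at reduced diameter `σ₂` tied to the
profile at `t = 0` through ANY admissible canonical family `(m, Φm)`), every full family of flows `Ψ N n`, every guarded
`t < T₂`, every continuous `χ` and every 1-Lipschitz `F` bounded by `1`: there are `κ > 0`, `C` and `N₀` such that for
every activity `μ > 0` and `N ≥ N₀` whose MEAN COUNT lies in `[(1−κ)(σ₂/σ₁)³(N+1), (1+κ)(σ₂/σ₁)³(N+1)]`, the variance under
the Poissonised count law `p_{N,μ}(k) ∝ μᵏ Z_{N,k}/k!` of the canonical expectations `g(k) = E_{π_{N,k}} F(σ₂³·fields of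
Ψ_t z against χ)` is `≤ C/(N+1)`:  `(N+1)·(Σₖ p(k) g(k)² − (Σₖ p(k) g(k))²) ≤ C`. Rev 1 (`GCVarianceBound`, mixture variance of
the five field statistics) implies it by the law of total variance `Var(E[X | K]) ≤ Var(X)` and `|F(x) − F(m)| ≤ dist(x, m)`;
conversely it is exactly the `√N`-WINDOW INSENSITIVITY at CLT rate of the canonical time-`t` expectations that PNM needs.
Why plausibly true: as rev 1 (finite compressibility at `t = 0`; an identity at global equilibrium; bounded `L²` amplification
of the fluctuation field pre-shock, Spohn 1991 Part II §7.1; ensemble corrections `O(1/N)`, LebowitzPercusVerlet1967). Why it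
might fail: it is the determinism half of the hydrodynamic limit at rate `1/N` in ONE scalar direction (the total number), in
print for no deterministic gas. True for the ideal gas (so it cannot imply the crux alone — the locality is in `stub_cone`).
Leans on: `canonicalPartition`, `gcPartition`, `particleLaw`, `canonicalDensity`, `HardSphereFlow.measurePreserving`;
LebowitzPercusVerlet1967 (doi:10.1103/physrev.153.250), Spohn1991 Part II, KipnisLandim1999 App. 2. -/
theorem stub_var :
    ∃ η₀ : ℝ, 0 < η₀ ∧ ∀ M : ℝ, 0 < M →
    ∀ (a₂ θ₂ : T3 → ℝ) (u₂ : T3 → V3), Continuous a₂ → Continuous θ₂ → Continuous u₂ →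
      (∀ x, 0 < a₂ x) → (∀ x, 0 < θ₂ x) →
    ∃ σ₀ : ℝ, 0 < σ₀ ∧ ∀ (σ₁ σ₂ : ℝ), 0 < σ₁ → σ₁ < σ₀ → 0 < σ₂ → σ₂ < σ₀ →
    ∀ (T₂ : ℝ) (ρ₂ Θ₂ : ℝ → T3 → ℝ) (U₂ : ℝ → T3 → V3), IsHardSphereEulerSolution σ₂ T₂ ρ₂ U₂ Θ₂ →
    ∀ (m : ℕ → ℕ) (Φm : (N : ℕ) → HardSphereFlow G3 (hsDiameter σ₁ N) (m N)),
      Tendsto (fun N => (m N : ℝ) * hsDiameter σ₁ N ^ 3) atTop (𝓝 (σ₂ ^ 3)) →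
      (∀ N, IsProbabilityMeasure (particleLaw (Φm N)
        (canonicalDensity G3 (hsDiameter σ₁ N) (m N) (localGibbsProfile a₂ u₂ θ₂)))) →
      LLNAt m (fun N => particleLaw (Φm N)
        (canonicalDensity G3 (hsDiameter σ₁ N) (m N) (localGibbsProfile a₂ u₂ θ₂))) Φm
        (ρ₂ 0) (U₂ 0) (Θ₂ 0) 0 →
    ∀ Ψ : (N n : ℕ) → HardSphereFlow G3 (hsDiameter σ₁ N) n,
    ∀ t : ℝ, 0 ≤ t → t < T₂ →
      (∀ s ∈ Set.Icc 0 t, ∀ x, ρ₂ s x * σ₂ ^ 3 < η₀ ∧ Θ₂ s x ≤ M ∧ ‖U₂ s x‖ ≤ M) →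
    ∀ χ : T3 → ℝ, Continuous χ → ∀ F : ℝ × V3 × ℝ → ℝ, LipschitzWith 1 F → (∀ p, |F p| ≤ 1) →
    ∃ κ : ℝ, 0 < κ ∧ ∃ C : ℝ, ∃ N₀ : ℕ, ∀ μ : ℝ, 0 < μ → ∀ N : ℕ, N₀ ≤ N →
      (1 - κ) * ((σ₂ / σ₁) ^ 3 * ((N + 1 : ℕ) : ℝ)) ≤ meanCount σ₁ (localGibbsProfile a₂ u₂ θ₂) μ N →
      meanCount σ₁ (localGibbsProfile a₂ u₂ θ₂) μ N ≤ (1 + κ) * ((σ₂ / σ₁) ^ 3 * ((N + 1 : ℕ) : ℝ)) →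
      ((N + 1 : ℕ) : ℝ) *
        (wMean (canonicalWeights σ₁ (localGibbsProfile a₂ u₂ θ₂) N)
            (fun n => (canonicalMean σ₁ (localGibbsProfile a₂ u₂ θ₂) N n (Ψ N n)
              (fun z => F (σ₂ ^ 3 * empiricalDensityField ((Ψ N n).flow t z) χ,
                (σ₂ ^ 3) • empiricalMomentumField ((Ψ N n).flow t z) χ,
                σ₂ ^ 3 * empiricalEnergyField ((Ψ N n).flow t z) χ))) ^ 2) μ -
          wMean (canonicalWeights σ₁ (localGibbsProfile a₂ u₂ θ₂) N)
            (fun n => canonicalMean σ₁ (localGibbsProfile a₂ u₂ θ₂) N n (Ψ N n)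
              (fun z => F (σ₂ ^ 3 * empiricalDensityField ((Ψ N n).flow t z) χ,
                (σ₂ ^ 3) • empiricalMomentumField ((Ψ N n).flow t z) χ,
                σ₂ ^ 3 * empiricalEnergyField ((Ψ N n).flow t z) χ))) μ ^ 2) ≤ C := by
  sorry

/-- STUB `stub_countIVT` (kind: statics; size M; provable now; rev 2 = part (a) of rev 1's `stub_countCLT`). **EVERY CENTRE OF
THE WINDOW IS A MEAN COUNT.** For `σ₁, σ₂ < σ₀` there are `κ > 0` and `N₀` such that for `N ≥ N₀` every
`mc ∈ [(1−κ)(σ₂/σ₁)³(N+1), (1+κ)(σ₂/σ₁)³(N+1)]` is `meanCount σ₁ f μ N` for some activity `μ > 0`. Why true: the weights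
`w_k = Z_{N,k}/k!` are `≥ 0` with `w_0 = 1` (`canonicalPartition_zero`) and `Σ w_k rᵏ < ∞` (`Z_{N,k} ≤ (∫ f)ᵏ`); the mean count
`Σ k w_k μᵏ / Σ w_k μᵏ` is continuous (indeed differentiable, `stub_susceptibility`) and nondecreasing in `μ` (derivative
`= μ⁻¹ Var ≥ 0`), tends to `0` as `μ → 0⁺`, and for large `μ` exceeds `m₀ − 1` whenever `w_{m₀} > 0`; `w_{m₀} > 0` for
`m₀ = ⌈(1+κ)(σ₂/σ₁)³(N+1)⌉₊ + 1` because that many spheres of diameter `hsDiameter σ₁ N` still fit (`posPartition_pos` at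
reduced diameter `1/2` + `posPartition_antitone_diam`, as in `isProbabilityMeasure_commensurate`; needs `σ₀ ≤ 1/4`, `κ ≤ 1`);
conclude by the intermediate value theorem. Leans on: `canonicalPartition_zero/_nonneg`, `canonicalPartition_eq_posPartition`,
`posPartition_pos`, `NearConstantShortTimeHL.posPartition_antitone_diam`, Mathlib `intermediate_value_Icc`. -/
theorem stub_countIVT :
    ∀ (a₂ θ₂ : T3 → ℝ) (u₂ : T3 → V3), Continuous a₂ → Continuous θ₂ → Continuous u₂ →
      (∀ x, 0 < a₂ x) → (∀ x, 0 < θ₂ x) →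
    ∃ σ₀ : ℝ, 0 < σ₀ ∧ ∀ (σ₁ σ₂ : ℝ), 0 < σ₁ → σ₁ < σ₀ → 0 < σ₂ → σ₂ < σ₀ →
    ∃ κ : ℝ, 0 < κ ∧ ∃ N₀ : ℕ, ∀ N : ℕ, N₀ ≤ N →
      ∀ mc : ℝ, (1 - κ) * ((σ₂ / σ₁) ^ 3 * ((N + 1 : ℕ) : ℝ)) ≤ mc →
        mc ≤ (1 + κ) * ((σ₂ / σ₁) ^ 3 * ((N + 1 : ℕ) : ℝ)) →
        ∃ μ : ℝ, 0 < μ ∧ meanCount σ₁ (localGibbsProfile a₂ u₂ θ₂) μ N = mc :=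
  CountIVT.stub_countIVT

/-- STUB `stub_countLCLT` (kind: statics; size L; in print, unformalised; rev 2 = parts (b), (c) of rev 1's `stub_countCLT`).
**LOCAL CENTRAL LIMIT STATICS OF THE POISSONISED COUNT LAW** `p_{N,μ}(n) ∝ μⁿ Z_{N,n}/n!` of the low-activity hard-sphere gas
with the inhomogeneous profile `(a₂,u₂,θ₂)`: for `σ₁, σ₂ < σ₀` there are `κ, s₀, s₁, c₀ > 0` and `N₀` such that for `N ≥ N₀`
and every activity whose mean count lies in the window: (b) the count variance is TWO-SIDED linear,
`s₀(N+1) ≤ Var ≤ s₁(N+1)` (finite positive compressibility, `Var/Mean = 1 + O(packing)`); (c) local lower bound at the mean,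
`√(N+1) · p_{N,μ}(n) ≥ c₀` for `|n − mean| ≤ 1` (local CLT for the particle number). Why plausibly true: standard consequences of
the convergent low-activity cluster expansion for hard spheres with a bounded continuous activity profile (analytic pressure,
cumulants `≍` volume, zero-free disc ⇒ Gaussian local limit for `N_Λ`). Why it might fail: only by mis-typing (window leaving
the convergence radius — excluded volume × activity is `O(σ₀³)` here). Leans on: `canonicalPartition`, `gcPartition`,
`posPartition_pos`, tree cluster-expansion statics (`activity_inversion_continuous`, `GeneralFamilyConcentration`,
`staticLLN_explicit`); Ruelle1969 Ch. 4, PulvirentiTsagkarogiannis2012 Thm 2.1, Dobrushin–Tirozzi 1977 (doi:10.1007/bf01614136),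
doi:10.1063/1.524261 (local limit theorem for Gibbs particle systems), Michelen–Perkins (doi:10.1007/s00220-022-04559-8),
Jenssen–Michelen–Ravichandran (CLT/LCLT for hard spheres at low fugacity). -/
theorem stub_countLCLT :
    ∀ (a₂ θ₂ : T3 → ℝ) (u₂ : T3 → V3), Continuous a₂ → Continuous θ₂ → Continuous u₂ →
      (∀ x, 0 < a₂ x) → (∀ x, 0 < θ₂ x) →
    ∃ σ₀ : ℝ, 0 < σ₀ ∧ ∀ (σ₁ σ₂ : ℝ), 0 < σ₁ → σ₁ < σ₀ → 0 < σ₂ → σ₂ < σ₀ →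
    ∃ κ : ℝ, 0 < κ ∧ ∃ s₀ : ℝ, 0 < s₀ ∧ ∃ s₁ : ℝ, 0 < s₁ ∧ ∃ c₀ : ℝ, 0 < c₀ ∧ ∃ N₀ : ℕ,
    ∀ N : ℕ, N₀ ≤ N → ∀ μ : ℝ, 0 < μ →
        (1 - κ) * ((σ₂ / σ₁) ^ 3 * ((N + 1 : ℕ) : ℝ)) ≤ meanCount σ₁ (localGibbsProfile a₂ u₂ θ₂) μ N →
        meanCount σ₁ (localGibbsProfile a₂ u₂ θ₂) μ N ≤ (1 + κ) * ((σ₂ / σ₁) ^ 3 * ((N + 1 : ℕ) : ℝ)) →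
        s₀ * ((N + 1 : ℕ) : ℝ) ≤ varCount σ₁ (localGibbsProfile a₂ u₂ θ₂) μ N ∧
        varCount σ₁ (localGibbsProfile a₂ u₂ θ₂) μ N ≤ s₁ * ((N + 1 : ℕ) : ℝ) ∧
        ∀ n : ℕ, |(n : ℝ) - meanCount σ₁ (localGibbsProfile a₂ u₂ θ₂) μ N| ≤ 1 →
          c₀ ≤ Real.sqrt ((N + 1 : ℕ) : ℝ) * countWeight σ₁ (localGibbsProfile a₂ u₂ θ₂) μ N n :=
  CountLCLT.stub_countLCLT

/-- STUB `stub_susceptibility` (kind: lever / calculus; size M; provable now). **THE SUSCEPTIBILITY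
(FLUCTUATION–RESPONSE) IDENTITY FOR AN EXPONENTIAL FAMILY OF WEIGHTS ON `ℕ`.** For weights `w ≥ 0` with `w 0 > 0`
and `Σ wₙ rⁿ < ∞` for every `r > 0` (entire generating function — the hard-sphere weights `Z_{N,n}/n! ≤ (∫f)ⁿ/n!`
qualify), and a polynomially bounded `g`, the family mean `ν ↦ ⟨g⟩_ν = Σ wₙνⁿg(n)/Σ wₙνⁿ` is differentiable on
`(0,∞)` with `d/dν ⟨g⟩_ν = ν⁻¹ (⟨n g⟩_ν − ⟨n⟩_ν ⟨g⟩_ν) = ν⁻¹ Cov_{p_ν}(n, g)`. With `g(n) = n` this is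
`d⟨n⟩/d log ν = Var_ν(n)` (the window ↔ activity dictionary); with `g(n) = E_{π_n} F(X_t)` it is the card's lever
`∂_{log μ} E_μ[F(X_t)] = Cov_μ(N_tot, F(X_t))`, whence `|∂_{log μ} E_μ F| ≤ SD(N_tot)·SD_{p}(g)`. Why true: termwise
differentiation of two power series inside their (infinite) radius of convergence and the quotient rule.
Leans on: Mathlib `hasDerivAt_tsum` / `HasFPowerSeriesOnBall`, `HasDerivAt.div`; tree analogue
`QuantumLattice.hasDerivAt_integral_tilted_eq_covariance` (WilsonFeynmanHellmann.lean, the tilt-covariance identity). -/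
theorem stub_susceptibility :
    ∀ (w g : ℕ → ℝ), (∀ n, 0 ≤ w n) → 0 < w 0 →
      (∀ r : ℝ, 0 < r → Summable fun n => w n * r ^ n) →
      (∃ B : ℝ, ∃ k : ℕ, ∀ n, |g n| ≤ B * ((n : ℝ) + 1) ^ k) →
    ∀ ν : ℝ, 0 < ν →
      HasDerivAt (wMean w g)
        (ν⁻¹ * (wMean w (fun n => (n : ℝ) * g n) ν - wMean w (fun n => (n : ℝ)) ν * wMean w g ν)) ν :=
  Susceptibility.stub_susceptibility

/-- STUB `stub_chain` (kind: analysis; size M; provable now; rev 2 = the ABSTRACT CHAIN LEMMA with explicit bounds — pure real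
analysis on an exponential family of weights on `ℕ`; the hard-sphere instantiation and the limit `N → ∞` are the sorry-free glue
`pnm_of_stubs` below). For weights `w ≥ 0`, `w 0 > 0`, `Σ wₙ rⁿ < ∞ (∀ r > 0)`, a function `|g| ≤ 1`, a window of mean counts
`[lo, hi]`, a scale `L > 0` and constants: IF the susceptibility identity holds for `w` (hypothesis SUS = `stub_susceptibility`'s
conclusion), the family variance of `g` is `≤ C/L` whenever the mean count `M(μ) = ⟨n⟩_μ` lies in the window (VAR = `stub_var`'s
conclusion at one `N`, `L = N+1`), the count variance is two-sided `s₀L ≤ V(μ) ≤ s₁L` and the weight at the mean is `≥ c₀/√L` on the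
window (LCLT = `stub_countLCLT`'s conclusion), and two activities `μ₁, μ₂` realise two window integers `m₁, m₂` as mean counts
(from `stub_countIVT`), THEN `|g m₁ − g m₂| ≤ 2√(C/(c₀√L)) + √(s₁C)·|m₁ − m₂|/(s₀L)`. Proof: (pointwise extraction)
`p(mᵢ)(g mᵢ − ḡ μᵢ)² ≤ Var_g(μᵢ) ≤ C/L` and `p(mᵢ) ≥ c₀/√L`; (drift) in `s = log μ`: `dM/ds = V ≥ 0` (so `M` is monotone and stays
in the window between `log μ₁` and `log μ₂`, where `V ≥ s₀L` gives `|log μ₁ − log μ₂| ≤ |m₁ − m₂|/(s₀L)`), and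
`|dḡ/ds| = |Cov(n, g)| ≤ √V·√Var_g ≤ √(s₁C)` there (weighted Cauchy–Schwarz; mean value inequality); (triangle). Why it might fail:
it cannot (pure analysis). Leans on: Mathlib (`HasDerivAt.comp`, `Real.hasDerivAt_exp`, `Convex.mul_sub_le_image_sub_of_le_deriv`,
`Convex.norm_image_sub_le_of_norm_hasDerivWithin_le`, `monotoneOn_of_deriv_nonneg`, `tsum` algebra). -/
theorem stub_chain :
    ∀ (w g : ℕ → ℝ) (lo hi L C c₀ s₀ s₁ μ₁ μ₂ : ℝ) (m₁ m₂ : ℕ),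
      (∀ n, 0 ≤ w n) → 0 < w 0 → (∀ r : ℝ, 0 < r → Summable fun n => w n * r ^ n) →
      (∀ n, |g n| ≤ 1) → 0 < L → 0 < c₀ → 0 < s₀ →
      (∀ g' : ℕ → ℝ, (∃ B : ℝ, ∃ k : ℕ, ∀ n, |g' n| ≤ B * ((n : ℝ) + 1) ^ k) → ∀ ν : ℝ, 0 < ν →
        HasDerivAt (wMean w g')
          (ν⁻¹ * (wMean w (fun n => (n : ℝ) * g' n) ν - wMean w (fun n => (n : ℝ)) ν * wMean w g' ν)) ν) →
      (∀ μ : ℝ, 0 < μ → lo ≤ wMean w (fun n => (n : ℝ)) μ → wMean w (fun n => (n : ℝ)) μ ≤ hi →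
        L * (wMean w (fun n => g n ^ 2) μ - wMean w g μ ^ 2) ≤ C) →
      (∀ μ : ℝ, 0 < μ → lo ≤ wMean w (fun n => (n : ℝ)) μ → wMean w (fun n => (n : ℝ)) μ ≤ hi →
        s₀ * L ≤ wMean w (fun n => (n : ℝ) ^ 2) μ - wMean w (fun n => (n : ℝ)) μ ^ 2 ∧
        wMean w (fun n => (n : ℝ) ^ 2) μ - wMean w (fun n => (n : ℝ)) μ ^ 2 ≤ s₁ * L ∧
        ∀ n : ℕ, |(n : ℝ) - wMean w (fun n => (n : ℝ)) μ| ≤ 1 → c₀ ≤ Real.sqrt L * wP w μ n) →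
      0 < μ₁ → 0 < μ₂ → wMean w (fun n => (n : ℝ)) μ₁ = m₁ → wMean w (fun n => (n : ℝ)) μ₂ = m₂ →
      lo ≤ (m₁ : ℝ) → (m₁ : ℝ) ≤ hi → lo ≤ (m₂ : ℝ) → (m₂ : ℝ) ≤ hi →
      |g m₁ - g m₂| ≤
        2 * Real.sqrt (C / (c₀ * Real.sqrt L)) + Real.sqrt (s₁ * C) * |(m₁ : ℝ) - m₂| / (s₀ * L) :=
  Chain.stub_chain

end Holds

/-! ## Stub statements by name (D-0027 §3.3) -/

/-- Statement of `Holds.stub_cone` (R2, the commensurate two-copy cone in law). -/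
def stub_cone : Prop := type_of% Holds.stub_cone
/-- Statement of `Holds.stub_var` (count-conditional variance bound, the card's dynamic input, rev 2). -/
def stub_var : Prop := type_of% Holds.stub_var
/-- Statement of `Holds.stub_countIVT` (every centre of the window is a mean count). -/
def stub_countIVT : Prop := type_of% Holds.stub_countIVT
/-- Statement of `Holds.stub_countLCLT` (local CLT statics of the Poissonised count law). -/
def stub_countLCLT : Prop := type_of% Holds.stub_countLCLT
/-- Statement of `Holds.stub_susceptibility` (the exponential-family covariance identity). -/
def stub_susceptibility : Prop := type_of% Holds.stub_susceptibility
/-- Statement of `Holds.stub_chain` (the abstract chain lemma with explicit bounds). -/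
def stub_chain : Prop := type_of% Holds.stub_chain

/-- `GCVarianceBound` — the card's C⁺, by name (= `stub_var`, rev 2: count-conditional form). -/
abbrev GCVarianceBound : Prop := stub_var

/-! ## Small tools for the composition (sorry-free) -/

/-- **Limits in probability are unique (normed-group-valued).** [folklore] -/
theorem eq_of_tendsto_measure_lt_norm_sub {Ω : ℕ → Type*} [∀ N, MeasurableSpace (Ω N)]
    (P : (N : ℕ) → Measure (Ω N)) [∀ N, IsProbabilityMeasure (P N)] {E : Type*} [NormedAddCommGroup E]
    (X : (N : ℕ) → Ω N → E) {c₁ c₂ : E}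
    (h₁ : ∀ δ : ℝ, 0 < δ → Tendsto (fun N => P N {z | δ < ‖X N z - c₁‖}) atTop (𝓝 0))
    (h₂ : ∀ δ : ℝ, 0 < δ → Tendsto (fun N => P N {z | δ < ‖X N z - c₂‖}) atTop (𝓝 0)) :
    c₁ = c₂ := by
  by_contra hne
  have hδ : 0 < ‖c₁ - c₂‖ / 3 := div_pos (norm_pos_iff.2 (sub_ne_zero.2 hne)) (by norm_num)
  have hcover : ∀ N, (Set.univ : Set (Ω N)) ⊆
      {z | ‖c₁ - c₂‖ / 3 < ‖X N z - c₁‖} ∪ {z | ‖c₁ - c₂‖ / 3 < ‖X N z - c₂‖} := by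
    intro N z _
    by_contra hz
    simp only [Set.mem_union, Set.mem_setOf_eq, not_or, not_lt] at hz
    have h : ‖c₁ - c₂‖ ≤ ‖X N z - c₁‖ + ‖X N z - c₂‖ := by
      calc ‖c₁ - c₂‖ = ‖(X N z - c₂) - (X N z - c₁)‖ := by congr 1; abel
        _ ≤ ‖X N z - c₂‖ + ‖X N z - c₁‖ := norm_sub_le _ _
        _ = ‖X N z - c₁‖ + ‖X N z - c₂‖ := add_comm _ _
    linarith [hz.1, hz.2, norm_nonneg (c₁ - c₂)]
  have hge : ∀ N, (1 : ℝ≥0∞) ≤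
      P N {z | ‖c₁ - c₂‖ / 3 < ‖X N z - c₁‖} + P N {z | ‖c₁ - c₂‖ / 3 < ‖X N z - c₂‖} :=
    fun N => (measure_univ (μ := P N)).symm.le.trans
      ((measure_mono (hcover N)).trans (measure_union_le _ _))
  have hlim := (h₁ _ hδ).add (h₂ _ hδ)
  rw [add_zero] at hlim
  exact absurd (ge_of_tendsto' hlim hge) (by simp)

/-- **Transfer of the time-`t` law of large numbers between two families with a common static limit.** If family
A satisfies the LLN towards `(ρa, ua, θa)` AND towards `(ρ, U, Θ)` (probability laws), and family B satisfies it
towards `(ρa, ua, θa)`, then family B satisfies it towards `(ρ, U, Θ)`: the tested limits coincide by uniqueness of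
limits in probability. [folklore] -/
theorem llnAt_transfer {nA nB : ℕ → ℕ} {εA εB : ℕ → ℝ}
    {PA : (N : ℕ) → Measure (Config (nA N) (Fin 3) T3)}
    {PB : (N : ℕ) → Measure (Config (nB N) (Fin 3) T3)}
    (hPA : ∀ N, IsProbabilityMeasure (PA N))
    {ΦA : (N : ℕ) → HardSphereFlow G3 (εA N) (nA N)} {ΦB : (N : ℕ) → HardSphereFlow G3 (εB N) (nB N)}
    {ρa Θa ρ Θ : T3 → ℝ} {ua U : T3 → V3} {t : ℝ}
    (hA1 : LLNAt nA PA ΦA ρa ua Θa t) (hA2 : LLNAt nA PA ΦA ρ U Θ t) (hB : LLNAt nB PB ΦB ρa ua Θa t) :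
    LLNAt nB PB ΦB ρ U Θ t := by
  intro χ hχ δ hδ
  haveI := hPA
  obtain ⟨hB1, hB2, hB3⟩ := hB χ hχ δ hδ
  have e1 : (∫ x, χ x * ρa x) = ∫ x, χ x * ρ x :=
    ProfileId.eq_of_tendsto_measure_lt_abs_sub PA
      (fun N z => empiricalDensityField ((ΦA N).flow t z) χ)
      (fun δ' hδ' => (hA1 χ hχ δ' hδ').1) (fun δ' hδ' => (hA2 χ hχ δ' hδ').1)
  have e2 : (∫ x, (χ x * ρa x) • ua x) = ∫ x, (χ x * ρ x) • U x :=
    eq_of_tendsto_measure_lt_norm_sub PA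
      (fun N z => empiricalMomentumField ((ΦA N).flow t z) χ)
      (fun δ' hδ' => (hA1 χ hχ δ' hδ').2.1) (fun δ' hδ' => (hA2 χ hχ δ' hδ').2.1)
  have e3 : (∫ x, χ x * totalEnergyDensity (ρa x) (ua x) (Θa x)) =
      ∫ x, χ x * totalEnergyDensity (ρ x) (U x) (Θ x) :=
    ProfileId.eq_of_tendsto_measure_lt_abs_sub PA
      (fun N z => empiricalEnergyField ((ΦA N).flow t z) χ)
      (fun δ' hδ' => (hA1 χ hχ δ' hδ').2.2) (fun δ' hδ' => (hA2 χ hχ δ' hδ').2.2)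
  refine ⟨?_, ?_, ?_⟩
  · rw [← e1]; exact hB1
  · rw [← e2]; exact hB2
  · rw [← e3]; exact hB3

/-- The commensurate family `⌈q (N+1)⌉₊`, `q = (σ₂/σ₁)³`, satisfies the crux's asymptotic condition
`n · hsDiameter σ₁ N ^ 3 → σ₂³` (squeeze between `q σ₁³` and `q σ₁³ + σ₁³/(N+1)`).
-- adapted from `Lines/SketchRestatements.lean` (`tendsto_ceil_mul_hsDiameter`, lead c2) [folklore] -/
theorem tendsto_ceil_mul_hsDiameter {σ₁ σ₂ : ℝ} (hσ₁ : 0 < σ₁) (hσ₂ : 0 < σ₂) {n₂ : ℕ → ℕ}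
    (hn : ∀ N, n₂ N = ⌈(σ₂ / σ₁) ^ 3 * ((N + 1 : ℕ) : ℝ)⌉₊) :
    Tendsto (fun N => (n₂ N : ℝ) * hsDiameter σ₁ N ^ 3) atTop (𝓝 (σ₂ ^ 3)) := by
  set q : ℝ := (σ₂ / σ₁) ^ 3 with hq
  have hq0 : 0 ≤ q := by positivity
  have hσ₁3 : σ₁ ^ 3 ≠ 0 := by positivity
  have hqσ : q * σ₁ ^ 3 = σ₂ ^ 3 := by
    rw [hq, div_pow, div_mul_cancel₀ _ hσ₁3]
  have hlow : ∀ N, q * σ₁ ^ 3 ≤ (n₂ N : ℝ) * hsDiameter σ₁ N ^ 3 := by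
    intro N
    have hN : (0 : ℝ) < ((N + 1 : ℕ) : ℝ) := by positivity
    rw [hn N, hsDiameter_pow_three]
    calc q * σ₁ ^ 3 = (q * ((N + 1 : ℕ) : ℝ)) * (σ₁ ^ 3 / ((N + 1 : ℕ) : ℝ)) := by
          field_simp
      _ ≤ (⌈q * ((N + 1 : ℕ) : ℝ)⌉₊ : ℝ) * (σ₁ ^ 3 / ((N + 1 : ℕ) : ℝ)) := by
          gcongr
          exact Nat.le_ceil _
  have hup : ∀ N, (n₂ N : ℝ) * hsDiameter σ₁ N ^ 3 ≤ q * σ₁ ^ 3 + σ₁ ^ 3 / ((N + 1 : ℕ) : ℝ) := by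
    intro N
    have hN : (0 : ℝ) < ((N + 1 : ℕ) : ℝ) := by positivity
    rw [hn N, hsDiameter_pow_three]
    have h2 : (⌈q * ((N + 1 : ℕ) : ℝ)⌉₊ : ℝ) < q * ((N + 1 : ℕ) : ℝ) + 1 :=
      Nat.ceil_lt_add_one (by positivity)
    calc (⌈q * ((N + 1 : ℕ) : ℝ)⌉₊ : ℝ) * (σ₁ ^ 3 / ((N + 1 : ℕ) : ℝ))
        ≤ (q * ((N + 1 : ℕ) : ℝ) + 1) * (σ₁ ^ 3 / ((N + 1 : ℕ) : ℝ)) := by gcongr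
      _ = q * σ₁ ^ 3 + σ₁ ^ 3 / ((N + 1 : ℕ) : ℝ) := by field_simp
  have hlim : Tendsto (fun N : ℕ => q * σ₁ ^ 3 + σ₁ ^ 3 / ((N + 1 : ℕ) : ℝ)) atTop
      (𝓝 (q * σ₁ ^ 3)) := by
    have h0 : Tendsto (fun N : ℕ => σ₁ ^ 3 / ((N + 1 : ℕ) : ℝ)) atTop (𝓝 0) :=
      (tendsto_const_div_atTop_nhds_zero_nat (σ₁ ^ 3)).comp (tendsto_add_atTop_nat 1)
    simpa using tendsto_const_nhds.add h0
  rw [← hqσ]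
  exact tendsto_of_tendsto_of_tendsto_of_le_of_le tendsto_const_nhds hlim hlow hup

/-- **The commensurate canonical laws are probability measures, for every `N`** (`σ₁, σ₂ ≤ 1/4`): the
`n = ⌈(σ₂/σ₁)³(N+1)⌉₊ ≥ 1` spheres of diameter `hsDiameter σ₁ N` are LESS packed than `n` spheres of the conjunct
family at reduced diameter `1/2` (`hsDiameter σ₁ N ≤ hsDiameter (1/2) (n-1)` because
`σ₁³ n ≤ (σ₂³ + σ₁³)(N+1) ≤ (N+1)/8`), so `0 < posPartition` (`posPartition_pos` + `posPartition_antitone_diam`) and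
`isProbabilityMeasure_canonicalLaw` applies. [folklore] -/
theorem isProbabilityMeasure_commensurate {a θ : T3 → ℝ} {u : T3 → V3} (ha : Continuous a)
    (hθ : Continuous θ) (hu : Continuous u) (ha0 : ∀ x, 0 < a x) (hθ0 : ∀ x, 0 < θ x) {σ₁ σ₂ : ℝ}
    (hσ₁ : 0 < σ₁) (hσ₁4 : σ₁ ≤ 1 / 4) (hσ₂ : 0 < σ₂) (hσ₂4 : σ₂ ≤ 1 / 4) (N : ℕ) {n : ℕ}
    (hn : n = ⌈(σ₂ / σ₁) ^ 3 * ((N + 1 : ℕ) : ℝ)⌉₊) (Ψ : HardSphereFlow G3 (hsDiameter σ₁ N) n) :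
    IsProbabilityMeasure (particleLaw Ψ (canonicalDensity G3 (hsDiameter σ₁ N) n (localGibbsProfile a u θ))) := by
  obtain ⟨A, -, hA⟩ := exists_forall_abs_le_of_continuous ha
  have hA' : ∀ x, a x ≤ A := fun x => (le_abs_self _).trans (hA x)
  have ha0' : ∀ x, 0 ≤ a x := fun x => (ha0 x).le
  -- positivity of the configurational partition function
  have hq0 : 0 < (σ₂ / σ₁) ^ 3 * ((N + 1 : ℕ) : ℝ) := by positivity
  have hn1 : 1 ≤ n := by rw [hn]; exact Nat.one_le_ceil_iff.2 hq0
  obtain ⟨k, hk⟩ : ∃ k, n = k + 1 := ⟨n - 1, (Nat.sub_add_cancel hn1).symm⟩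
  have hkq : ((k + 1 : ℕ) : ℝ) < (σ₂ / σ₁) ^ 3 * ((N + 1 : ℕ) : ℝ) + 1 := by
    rw [← hk, hn]; exact Nat.ceil_lt_add_one hq0.le
  have hdiam : hsDiameter σ₁ N ≤ hsDiameter (1 / 2) k := by
    refine le_of_pow_le_pow_left₀ (by norm_num : (3 : ℕ) ≠ 0) (hsDiameter_pos (by norm_num) k).le ?_
    rw [hsDiameter_pow_three, hsDiameter_pow_three]
    have hN : (0 : ℝ) < ((N + 1 : ℕ) : ℝ) := by positivity
    have hk0 : (0 : ℝ) < ((k + 1 : ℕ) : ℝ) := by positivity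
    rw [div_le_div_iff₀ hN hk0]
    have hc3 : σ₁ ^ 3 * ((σ₂ / σ₁) ^ 3 * ((N + 1 : ℕ) : ℝ)) = σ₂ ^ 3 * ((N + 1 : ℕ) : ℝ) := by
      rw [div_pow]; field_simp
    have hσ₁3 : σ₁ ^ 3 ≤ (1 / 4) ^ 3 := pow_le_pow_left₀ hσ₁.le hσ₁4 3
    have hσ₂3 : σ₂ ^ 3 ≤ (1 / 4) ^ 3 := pow_le_pow_left₀ hσ₂.le hσ₂4 3
    have h1N : (1 : ℝ) ≤ ((N + 1 : ℕ) : ℝ) := by exact_mod_cast Nat.succ_le_succ (Nat.zero_le N)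
    have hN0 : (0 : ℝ) ≤ ((N + 1 : ℕ) : ℝ) := hN.le
    calc σ₁ ^ 3 * ((k + 1 : ℕ) : ℝ) ≤ σ₁ ^ 3 * ((σ₂ / σ₁) ^ 3 * ((N + 1 : ℕ) : ℝ) + 1) :=
          mul_le_mul_of_nonneg_left hkq.le (by positivity)
      _ = σ₂ ^ 3 * ((N + 1 : ℕ) : ℝ) + σ₁ ^ 3 := by rw [mul_add, hc3, mul_one]
      _ ≤ (1 / 4) ^ 3 * ((N + 1 : ℕ) : ℝ) + (1 / 4) ^ 3 * ((N + 1 : ℕ) : ℝ) := by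
          refine add_le_add (mul_le_mul_of_nonneg_right hσ₂3 hN0) ?_
          calc σ₁ ^ 3 ≤ (1 / 4) ^ 3 := hσ₁3
            _ = (1 / 4) ^ 3 * 1 := (mul_one _).symm
            _ ≤ (1 / 4) ^ 3 * ((N + 1 : ℕ) : ℝ) := mul_le_mul_of_nonneg_left h1N (by positivity)
      _ ≤ (1 / 2) ^ 3 * ((N + 1 : ℕ) : ℝ) := by nlinarith [hN0]
  have hZ : 0 < posPartition a (hsDiameter σ₁ N) n := by
    rw [hk]
    exact (posPartition_pos ha ha0 (le_refl (1 / 2 : ℝ)) k).trans_le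
      (NearConstantShortTimeHL.posPartition_antitone_diam ha.measurable ha0' hA' hdiam (k + 1))
  rw [particleLaw_eq, NearConstantShortTimeHL.liouville_withDensity_canonicalDensity]
  exact NearConstantShortTimeHL.isProbabilityMeasure_canonicalLaw ha.measurable hθ.measurable hu.measurable
    ha0' hA' hθ0 hZ

/-- **crux ⇒ `stub_cone`** (necessity certificate: the split at `stub_cone` loses nothing on that side).
-- adapted from `Lines/SketchRestatements.lean` (`commensurate_of_lightConeInLaw`, lead c2) [folklore] -/
theorem cone_of_lightConeInLaw :
    Summit.AtomisticToContinuum.HydrodynamicLimit.Theses.RelayRaceLocality.LightConeInLaw → stub_cone := by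
  intro h
  obtain ⟨η₀, hη₀, H⟩ := h
  refine ⟨η₀, hη₀, fun M hM => ?_⟩
  obtain ⟨c, hc, Hc⟩ := H M hM
  refine ⟨c, hc, ?_⟩
  intro a₁ θ₁ a₂ θ₂ u₁ u₂ ha₁ hθ₁ hu₁ ha₂ hθ₂ hu₂ ha₁0 hθ₁0 ha₂0 hθ₂0
  obtain ⟨σ₀, hσ₀, Hσ⟩ := Hc a₁ θ₁ a₂ θ₂ u₁ u₂ ha₁ hθ₁ hu₁ ha₂ hθ₂ hu₂ ha₁0 hθ₁0 ha₂0 hθ₂0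
  refine ⟨σ₀, hσ₀, ?_⟩
  intro σ₁ σ₂ hσ₁ hσ₁' hσ₂ hσ₂' n₂ hn₂
  exact Hσ σ₁ σ₂ hσ₁ hσ₁' hσ₂ hσ₂' n₂ (tendsto_ceil_mul_hsDiameter hσ₁ hσ₂ hn₂)

/-! ## Composition (sorry-free): the five registered stubs ⟹ the crux BY NAME -/

/-- **Canonical expectations of bounded observables are bounded**: `|E_{π_{N,k}} O| ≤ 1` for `|O| ≤ 1`, because the
canonical laws are sub-probabilities (mass `Z⁻¹·Z ∈ {0,1}`, `Var.particleLaw_canonical_univ_le_one`). [folklore] -/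
theorem abs_canonicalMean_le_one {a θ : T3 → ℝ} {u : T3 → V3} (ha : Continuous a) (hθ : Continuous θ)
    (hu : Continuous u) (ha0 : ∀ x, 0 ≤ a x) (hθ0 : ∀ x, 0 < θ x) (σ₁ : ℝ) (N k : ℕ)
    (Ψ : HardSphereFlow G3 (hsDiameter σ₁ N) k) {O : Config k (Fin 3) T3 → ℝ} (hO : ∀ z, |O z| ≤ 1) :
    |canonicalMean σ₁ (localGibbsProfile a u θ) N k Ψ O| ≤ 1 := by
  unfold canonicalMean
  set π := particleLaw Ψ (canonicalDensity G3 (hsDiameter σ₁ N) k (localGibbsProfile a u θ)) with hπ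
  have hπ1 : π univ ≤ 1 := Var.particleLaw_canonical_univ_le_one ha hθ hu ha0 hθ0 Ψ
  haveI : IsFiniteMeasure π := ⟨hπ1.trans_lt ENNReal.one_lt_top⟩
  have h1 : ‖∫ z, O z ∂π‖ ≤ 1 * π.real univ :=
    norm_integral_le_of_norm_le_const (Eventually.of_forall fun z => by
      rw [Real.norm_eq_abs]; exact hO z)
  have h2 : π.real univ ≤ 1 := by
    rw [measureReal_def]
    exact ENNReal.toReal_le_of_le_ofReal zero_le_one (by simpa using hπ1)
  rw [← Real.norm_eq_abs]
  linarith

/-- **PARTICLE-NUMBER MERGING (PNM) from the stubs** — the line's C⁺ ⟹ PNM, sorry-free glue (lead a1): for gas 2's profile,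
tie and guards as in `stub_var`, any full flow family `Ψ` and ANY two admissible number sequences `n, n'` (`n ε³, n' ε³ → σ₂³`),
the canonical time-`t` expectations of `F`(reduced fields against `χ`) with `n N` and with `n' N` spheres merge. Instantiate the
abstract chain `stub_chain` at `w = canonicalWeights σ₁ f N`, `g k = E_{π_{N,k}} F(…)`, `L = N+1`, window
`[(1−κ)q(N+1), (1+κ)q(N+1)]` (`κ = min` of the three stubs' `κ`), activities from `stub_countIVT`, bounds from `stub_var` /
`stub_countLCLT`, identity from `stub_susceptibility`; the right-hand side `2√(C/(c₀√(N+1))) + √(s₁C)|n N − n' N|/(s₀(N+1)) → 0`. -/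
theorem pnm_of_stubs (hvar : stub_var) (hivt : stub_countIVT) (hlclt : stub_countLCLT)
    (hsus : stub_susceptibility) (hchain : stub_chain) :
    ∃ η₀ : ℝ, 0 < η₀ ∧ ∀ M : ℝ, 0 < M →
    ∀ (a₂ θ₂ : T3 → ℝ) (u₂ : T3 → V3), Continuous a₂ → Continuous θ₂ → Continuous u₂ →
      (∀ x, 0 < a₂ x) → (∀ x, 0 < θ₂ x) →
    ∃ σ₀ : ℝ, 0 < σ₀ ∧ ∀ (σ₁ σ₂ : ℝ), 0 < σ₁ → σ₁ < σ₀ → 0 < σ₂ → σ₂ < σ₀ →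
    ∀ (T₂ : ℝ) (ρ₂ Θ₂ : ℝ → T3 → ℝ) (U₂ : ℝ → T3 → V3), IsHardSphereEulerSolution σ₂ T₂ ρ₂ U₂ Θ₂ →
    ∀ (m : ℕ → ℕ) (Φm : (N : ℕ) → HardSphereFlow G3 (hsDiameter σ₁ N) (m N)),
      Tendsto (fun N => (m N : ℝ) * hsDiameter σ₁ N ^ 3) atTop (𝓝 (σ₂ ^ 3)) →
      (∀ N, IsProbabilityMeasure (particleLaw (Φm N)
        (canonicalDensity G3 (hsDiameter σ₁ N) (m N) (localGibbsProfile a₂ u₂ θ₂)))) →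
      LLNAt m (fun N => particleLaw (Φm N)
        (canonicalDensity G3 (hsDiameter σ₁ N) (m N) (localGibbsProfile a₂ u₂ θ₂))) Φm
        (ρ₂ 0) (U₂ 0) (Θ₂ 0) 0 →
    ∀ Ψ : (N n : ℕ) → HardSphereFlow G3 (hsDiameter σ₁ N) n,
    ∀ t : ℝ, 0 ≤ t → t < T₂ →
      (∀ s ∈ Set.Icc 0 t, ∀ x, ρ₂ s x * σ₂ ^ 3 < η₀ ∧ Θ₂ s x ≤ M ∧ ‖U₂ s x‖ ≤ M) →
    ∀ (n n' : ℕ → ℕ), Tendsto (fun N => (n N : ℝ) * hsDiameter σ₁ N ^ 3) atTop (𝓝 (σ₂ ^ 3)) →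
      Tendsto (fun N => (n' N : ℝ) * hsDiameter σ₁ N ^ 3) atTop (𝓝 (σ₂ ^ 3)) →
    ∀ χ : T3 → ℝ, Continuous χ → ∀ F : ℝ × V3 × ℝ → ℝ, LipschitzWith 1 F → (∀ p, |F p| ≤ 1) →
      Tendsto (fun N =>
        (∫ z, F (σ₂ ^ 3 * empiricalDensityField ((Ψ N (n N)).flow t z) χ,
                (σ₂ ^ 3) • empiricalMomentumField ((Ψ N (n N)).flow t z) χ,
                σ₂ ^ 3 * empiricalEnergyField ((Ψ N (n N)).flow t z) χ)
          ∂(particleLaw (Ψ N (n N)) (canonicalDensity G3 (hsDiameter σ₁ N) (n N) (localGibbsProfile a₂ u₂ θ₂)))) -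
        ∫ z, F (σ₂ ^ 3 * empiricalDensityField ((Ψ N (n' N)).flow t z) χ,
                (σ₂ ^ 3) • empiricalMomentumField ((Ψ N (n' N)).flow t z) χ,
                σ₂ ^ 3 * empiricalEnergyField ((Ψ N (n' N)).flow t z) χ)
          ∂(particleLaw (Ψ N (n' N)) (canonicalDensity G3 (hsDiameter σ₁ N) (n' N) (localGibbsProfile a₂ u₂ θ₂))))
        atTop (𝓝 0) := by
  obtain ⟨η₀, hη₀, Hvar⟩ := (hvar : type_of% Holds.stub_var)
  refine ⟨η₀, hη₀, fun M hM => ?_⟩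
  intro a₂ θ₂ u₂ ha₂ hθ₂ hu₂ ha₂0 hθ₂0
  obtain ⟨σv, hσv, Hv⟩ := Hvar M hM a₂ θ₂ u₂ ha₂ hθ₂ hu₂ ha₂0 hθ₂0
  obtain ⟨σi, hσi, Hi⟩ := (hivt : type_of% Holds.stub_countIVT) a₂ θ₂ u₂ ha₂ hθ₂ hu₂ ha₂0 hθ₂0
  obtain ⟨σl, hσl, Hl⟩ := (hlclt : type_of% Holds.stub_countLCLT) a₂ θ₂ u₂ ha₂ hθ₂ hu₂ ha₂0 hθ₂0
  refine ⟨min σv (min σi σl), lt_min hσv (lt_min hσi hσl), ?_⟩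
  intro σ₁ σ₂ hσ₁ hσ₁' hσ₂ hσ₂' T₂ ρ₂ Θ₂ U₂ hsol m Φm hm hPm hLm Ψ t ht htT hguard n n' hn hn' χ hχ F hF
    hFb
  have hσ₁v : σ₁ < σv := hσ₁'.trans_le (min_le_left _ _)
  have hσ₂v : σ₂ < σv := hσ₂'.trans_le (min_le_left _ _)
  have hσ₁i : σ₁ < σi := hσ₁'.trans_le ((min_le_right _ _).trans (min_le_left _ _))
  have hσ₂i : σ₂ < σi := hσ₂'.trans_le ((min_le_right _ _).trans (min_le_left _ _))
  have hσ₁l : σ₁ < σl := hσ₁'.trans_le ((min_le_right _ _).trans (min_le_right _ _))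
  have hσ₂l : σ₂ < σl := hσ₂'.trans_le ((min_le_right _ _).trans (min_le_right _ _))
  obtain ⟨κv, hκv, C, N₀v, HC⟩ := Hv σ₁ σ₂ hσ₁ hσ₁v hσ₂ hσ₂v T₂ ρ₂ Θ₂ U₂ hsol m Φm hm hPm hLm Ψ t ht
    htT hguard χ hχ F hF hFb
  obtain ⟨κi, hκi, N₀i, HI⟩ := Hi σ₁ σ₂ hσ₁ hσ₁i hσ₂ hσ₂i
  obtain ⟨κl, hκl, s₀, hs₀, s₁, _hs₁, c₀, hc₀, N₀l, HL⟩ := Hl σ₁ σ₂ hσ₁ hσ₁l hσ₂ hσ₂l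
  have ha₂0' : ∀ x, 0 ≤ a₂ x := fun x => (ha₂0 x).le
  -- the common window parameter and the commensurate ratio
  have hq0 : 0 < (σ₂ / σ₁) ^ 3 := by positivity
  have hκ0 : 0 < min κv (min κi κl) := lt_min hκv (lt_min hκi hκl)
  have hκv' : min κv (min κi κl) ≤ κv := min_le_left _ _
  have hκi' : min κv (min κi κl) ≤ κi := (min_le_right _ _).trans (min_le_left _ _)
  have hκl' : min κv (min κi κl) ≤ κl := (min_le_right _ _).trans (min_le_right _ _)
  -- window inclusion: the common window sits inside each stub's window
  have hincl : ∀ {κ' : ℝ}, min κv (min κi κl) ≤ κ' → ∀ (X x : ℝ), 0 ≤ X →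
      (1 - min κv (min κi κl)) * X ≤ x → x ≤ (1 + min κv (min κi κl)) * X →
      (1 - κ') * X ≤ x ∧ x ≤ (1 + κ') * X := by
    intro κ' hκ' X x hX h1 h2
    exact ⟨(mul_le_mul_of_nonneg_right (by linarith) hX).trans h1,
      h2.trans (mul_le_mul_of_nonneg_right (by linarith) hX)⟩
  -- the canonical means of the observable, and their a-priori bound
  have hg1 : ∀ N k, |canonicalMean σ₁ (localGibbsProfile a₂ u₂ θ₂) N k (Ψ N k)
      (fun z => F (σ₂ ^ 3 * empiricalDensityField ((Ψ N k).flow t z) χ,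
        (σ₂ ^ 3) • empiricalMomentumField ((Ψ N k).flow t z) χ,
        σ₂ ^ 3 * empiricalEnergyField ((Ψ N k).flow t z) χ))| ≤ 1 := fun N k =>
    abs_canonicalMean_le_one ha₂ hθ₂ hu₂ ha₂0' hθ₂0 σ₁ N k (Ψ N k) fun z => hFb _
  -- the ratios `k N / (N+1)` converge to `(σ₂/σ₁)³`
  have hratio : ∀ {k : ℕ → ℕ},
      Tendsto (fun N => (k N : ℝ) * hsDiameter σ₁ N ^ 3) atTop (𝓝 (σ₂ ^ 3)) →
      Tendsto (fun N => (k N : ℝ) / ((N + 1 : ℕ) : ℝ)) atTop (𝓝 ((σ₂ / σ₁) ^ 3)) := by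
    intro k hk
    have hσ₁3 : σ₁ ^ 3 ≠ 0 := by positivity
    have h1 := hk.mul_const ((σ₁ ^ 3)⁻¹)
    have hq' : σ₂ ^ 3 * (σ₁ ^ 3)⁻¹ = (σ₂ / σ₁) ^ 3 := by rw [div_pow, div_eq_mul_inv]
    rw [hq'] at h1
    refine h1.congr fun N => ?_
    have hN1 : (0 : ℝ) < ((N + 1 : ℕ) : ℝ) := by positivity
    rw [hsDiameter_pow_three]
    field_simp
  -- eventually both particle numbers lie in the common window
  have hwin : ∀ {k : ℕ → ℕ},
      Tendsto (fun N => (k N : ℝ) * hsDiameter σ₁ N ^ 3) atTop (𝓝 (σ₂ ^ 3)) →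
      ∀ᶠ N in atTop, (1 - min κv (min κi κl)) * ((σ₂ / σ₁) ^ 3 * ((N + 1 : ℕ) : ℝ)) ≤ (k N : ℝ) ∧
        (k N : ℝ) ≤ (1 + min κv (min κi κl)) * ((σ₂ / σ₁) ^ 3 * ((N + 1 : ℕ) : ℝ)) := by
    intro k hk
    have hlo : (1 - min κv (min κi κl)) * (σ₂ / σ₁) ^ 3 < (σ₂ / σ₁) ^ 3 := by nlinarith
    have hhi : (σ₂ / σ₁) ^ 3 < (1 + min κv (min κi κl)) * (σ₂ / σ₁) ^ 3 := by nlinarith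
    filter_upwards [(hratio hk).eventually (Ioo_mem_nhds hlo hhi)] with N hN
    have hN1 : (0 : ℝ) < ((N + 1 : ℕ) : ℝ) := by positivity
    rw [lt_div_iff₀ hN1, div_lt_iff₀ hN1] at hN
    obtain ⟨h1, h2⟩ := hN
    rw [mul_assoc] at h1 h2
    exact ⟨h1.le, h2.le⟩
  -- the explicit bound of the abstract chain, eventually
  have hbound : ∀ᶠ N in atTop,
      ‖canonicalMean σ₁ (localGibbsProfile a₂ u₂ θ₂) N (n N) (Ψ N (n N))
          (fun z => F (σ₂ ^ 3 * empiricalDensityField ((Ψ N (n N)).flow t z) χ,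
            (σ₂ ^ 3) • empiricalMomentumField ((Ψ N (n N)).flow t z) χ,
            σ₂ ^ 3 * empiricalEnergyField ((Ψ N (n N)).flow t z) χ)) -
        canonicalMean σ₁ (localGibbsProfile a₂ u₂ θ₂) N (n' N) (Ψ N (n' N))
          (fun z => F (σ₂ ^ 3 * empiricalDensityField ((Ψ N (n' N)).flow t z) χ,
            (σ₂ ^ 3) • empiricalMomentumField ((Ψ N (n' N)).flow t z) χ,
            σ₂ ^ 3 * empiricalEnergyField ((Ψ N (n' N)).flow t z) χ))‖ ≤
      2 * Real.sqrt (C / (c₀ * Real.sqrt ((N + 1 : ℕ) : ℝ))) +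
        Real.sqrt (s₁ * C) * |((n N : ℕ) : ℝ) - ((n' N : ℕ) : ℝ)| / (s₀ * ((N + 1 : ℕ) : ℝ)) := by
    filter_upwards [hwin hn, hwin hn', eventually_ge_atTop (max N₀v (max N₀i N₀l))] with N hwn hwn' hN
    have hNv : N₀v ≤ N := (le_max_left _ _).trans hN
    have hNi : N₀i ≤ N := ((le_max_left _ _).trans (le_max_right _ _)).trans hN
    have hNl : N₀l ≤ N := ((le_max_right _ _).trans (le_max_right _ _)).trans hN
    have hL0 : (0 : ℝ) < ((N + 1 : ℕ) : ℝ) := by positivity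
    have hX : (0 : ℝ) ≤ (σ₂ / σ₁) ^ 3 * ((N + 1 : ℕ) : ℝ) := by positivity
    -- the weights and the observable at this `N`
    set w : ℕ → ℝ := canonicalWeights σ₁ (localGibbsProfile a₂ u₂ θ₂) N with hw
    set g : ℕ → ℝ := fun k => canonicalMean σ₁ (localGibbsProfile a₂ u₂ θ₂) N k (Ψ N k)
      (fun z => F (σ₂ ^ 3 * empiricalDensityField ((Ψ N k).flow t z) χ,
        (σ₂ ^ 3) • empiricalMomentumField ((Ψ N k).flow t z) χ,
        σ₂ ^ 3 * empiricalEnergyField ((Ψ N k).flow t z) χ)) with hg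
    have hw0 : ∀ k, 0 ≤ w k := CountIVT.canonicalWeights_nonneg ha₂ hθ₂ hu₂ ha₂0' hθ₂0 σ₁ N
    have hw1 : 0 < w 0 := by
      rw [hw, CountIVT.canonicalWeights_zero ha₂ hθ₂ hu₂ ha₂0' hθ₂0 σ₁ N]; exact one_pos
    have hws : ∀ r : ℝ, 0 < r → Summable fun k => w k * r ^ k :=
      CountIVT.summable_canonicalWeights_mul_pow ha₂ hθ₂ hu₂ ha₂0' hθ₂0 σ₁ N
    have hgb : ∀ k, |g k| ≤ 1 := fun k => hg1 N k
    -- activities realising the two particle numbers (IVT)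
    obtain ⟨μ₁, hμ₁, hm₁⟩ := HI N hNi (n N) (hincl hκi' _ _ hX hwn.1 hwn.2).1
      (hincl hκi' _ _ hX hwn.1 hwn.2).2
    obtain ⟨μ₂, hμ₂, hm₂⟩ := HI N hNi (n' N) (hincl hκi' _ _ hX hwn'.1 hwn'.2).1
      (hincl hκi' _ _ hX hwn'.1 hwn'.2).2
    -- the susceptibility identity for these weights
    have hSUS : ∀ g' : ℕ → ℝ, (∃ B : ℝ, ∃ k : ℕ, ∀ n, |g' n| ≤ B * ((n : ℝ) + 1) ^ k) →
        ∀ ν : ℝ, 0 < ν → HasDerivAt (wMean w g')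
          (ν⁻¹ * (wMean w (fun n => (n : ℝ) * g' n) ν - wMean w (fun n => (n : ℝ)) ν * wMean w g' ν)) ν :=
      fun g' hg' ν hν => (hsus : type_of% Holds.stub_susceptibility) w g' hw0 hw1 hws hg' ν hν
    -- the variance bound on the common window
    have hVAR : ∀ μ : ℝ, 0 < μ → (1 - min κv (min κi κl)) * ((σ₂ / σ₁) ^ 3 * ((N + 1 : ℕ) : ℝ)) ≤
        wMean w (fun n => (n : ℝ)) μ → wMean w (fun n => (n : ℝ)) μ ≤
        (1 + min κv (min κi κl)) * ((σ₂ / σ₁) ^ 3 * ((N + 1 : ℕ) : ℝ)) →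
        ((N + 1 : ℕ) : ℝ) * (wMean w (fun n => g n ^ 2) μ - wMean w g μ ^ 2) ≤ C := by
      intro μ hμ h1 h2
      exact HC μ hμ N hNv (hincl hκv' _ _ hX h1 h2).1 (hincl hκv' _ _ hX h1 h2).2
    -- the count statics on the common window
    have hLCLT : ∀ μ : ℝ, 0 < μ → (1 - min κv (min κi κl)) * ((σ₂ / σ₁) ^ 3 * ((N + 1 : ℕ) : ℝ)) ≤
        wMean w (fun n => (n : ℝ)) μ → wMean w (fun n => (n : ℝ)) μ ≤
        (1 + min κv (min κi κl)) * ((σ₂ / σ₁) ^ 3 * ((N + 1 : ℕ) : ℝ)) →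
        s₀ * ((N + 1 : ℕ) : ℝ) ≤ wMean w (fun n => (n : ℝ) ^ 2) μ - wMean w (fun n => (n : ℝ)) μ ^ 2 ∧
        wMean w (fun n => (n : ℝ) ^ 2) μ - wMean w (fun n => (n : ℝ)) μ ^ 2 ≤ s₁ * ((N + 1 : ℕ) : ℝ) ∧
        ∀ k : ℕ, |(k : ℝ) - wMean w (fun n => (n : ℝ)) μ| ≤ 1 →
          c₀ ≤ Real.sqrt ((N + 1 : ℕ) : ℝ) * wP w μ k := by
      intro μ hμ h1 h2
      exact HL N hNl μ hμ (hincl hκl' _ _ hX h1 h2).1 (hincl hκl' _ _ hX h1 h2).2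
    -- the abstract chain
    have key := (hchain : type_of% Holds.stub_chain) w g _ _ _ C c₀ s₀ s₁ μ₁ μ₂ (n N) (n' N) hw0 hw1 hws
      hgb hL0 hc₀ hs₀ hSUS hVAR hLCLT hμ₁ hμ₂ hm₁ hm₂ hwn.1 hwn.2 hwn'.1 hwn'.2
    rw [Real.norm_eq_abs]
    exact key
  -- the explicit bound tends to zero
  have hsqrtN : Tendsto (fun N : ℕ => Real.sqrt ((N + 1 : ℕ) : ℝ)) atTop atTop :=
    Real.tendsto_sqrt_atTop.comp (tendsto_natCast_atTop_atTop.comp (tendsto_add_atTop_nat 1))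
  have h1 : Tendsto (fun N : ℕ => C / (c₀ * Real.sqrt ((N + 1 : ℕ) : ℝ))) atTop (𝓝 0) :=
    tendsto_const_nhds.div_atTop (hsqrtN.const_mul_atTop hc₀)
  have h2 : Tendsto (fun N : ℕ => 2 * Real.sqrt (C / (c₀ * Real.sqrt ((N + 1 : ℕ) : ℝ)))) atTop (𝓝 0) := by
    have h := ((Real.continuous_sqrt.tendsto 0).comp h1).const_mul 2
    rw [Real.sqrt_zero, mul_zero] at h
    exact h
  have h3 : Tendsto (fun N : ℕ => Real.sqrt (s₁ * C) * |((n N : ℕ) : ℝ) - ((n' N : ℕ) : ℝ)| /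
      (s₀ * ((N + 1 : ℕ) : ℝ))) atTop (𝓝 0) := by
    have hd := ((hratio hn).sub (hratio hn')).abs.const_mul (Real.sqrt (s₁ * C) / s₀)
    rw [sub_self, abs_zero, mul_zero] at hd
    refine hd.congr fun N => ?_
    have hN1 : (0 : ℝ) < ((N + 1 : ℕ) : ℝ) := by positivity
    rw [← sub_div, abs_div, abs_of_pos hN1]
    field_simp
  have hR := h2.add h3
  rw [add_zero] at hR
  exact squeeze_zero_norm' hbound hR

/-- **The skeleton theorem** (rev 2: only the two OPEN stubs `stub_cone`, `stub_var` are hypotheses; the four landed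
stubs are discharged inside by name). `η₀ := min η₀(cone) η₀(PNM)`, `c := c(cone)`,
`σ₀ := min (σ₀(cone), σ₀(PNM), σ₀(static LLN of gas 2's profile), 1/4)` (PNM = `stub_chain` fed `stub_var`,
`stub_countIVT`, `stub_countLCLT`, `stub_susceptibility`). Given the crux's data with an arbitrary
commensurate `n₂`: extend the flows `Φ₂` to a full family `Ψ` (Alexander), let `n₂* N = ⌈(σ₂/σ₁)³(N+1)⌉₊`; the
`n₂*`-gas has probability laws (`isProbabilityMeasure_commensurate`) and inherits the `t = 0` tie from the `n₂`-gas
(`staticLLN_explicit` for both families + `llnAt_transfer`); `stub_cone` merges gas 1 with the `n₂*`-gas inside the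
cone, `stub_chain` (fed `stub_var`, `stub_countCLT`, `stub_susceptibility`) merges the `n₂*`-gas with the `n₂`-gas
for every `χ`; add the two. -/
theorem LightConeInLaw_of (hcone : stub_cone) (hvar : stub_var) :
    Summit.AtomisticToContinuum.HydrodynamicLimit.Theses.RelayRaceLocality.LightConeInLaw := by
  obtain ⟨η₁, hη₁, Hcone⟩ := (hcone : type_of% Holds.stub_cone)
  -- the four LANDED stubs are discharged here by name (p123767, p126108, p123631, p124174)
  obtain ⟨η₂, hη₂, Hpnm⟩ := pnm_of_stubs hvar Holds.stub_countIVT Holds.stub_countLCLT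
    Holds.stub_susceptibility Holds.stub_chain
  refine ⟨min η₁ η₂, lt_min hη₁ hη₂, fun M hM => ?_⟩
  obtain ⟨c, hc0, Hc⟩ := Hcone M hM
  have Hp := Hpnm M hM
  refine ⟨c, hc0, ?_⟩
  intro a₁ θ₁ a₂ θ₂ u₁ u₂ ha₁ hθ₁ hu₁ ha₂ hθ₂ hu₂ ha₁0 hθ₁0 ha₂0 hθ₂0
  obtain ⟨σc, hσc, Hσc⟩ := Hc a₁ θ₁ a₂ θ₂ u₁ u₂ ha₁ hθ₁ hu₁ ha₂ hθ₂ hu₂ ha₁0 hθ₁0 ha₂0 hθ₂0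
  obtain ⟨σp, hσp, Hσp⟩ := Hp a₂ θ₂ u₂ ha₂ hθ₂ hu₂ ha₂0 hθ₂0
  obtain ⟨σs, hσs, Hσs⟩ := NearConstantShortTimeHL.staticLLN_explicit a₂ θ₂ u₂ ha₂ hθ₂ hu₂ ha₂0 hθ₂0
  refine ⟨min (min σc σp) (min σs (1 / 4)), lt_min (lt_min hσc hσp) (lt_min hσs (by norm_num)), ?_⟩
  intro σ₁ σ₂ hσ₁ hσ₁' hσ₂ hσ₂' n₂ hn₂ T₁ T₂ ρ₁ Θ₁ ρ₂ Θ₂ U₁ U₂ hsol₁ hsol₂ Φ₁ Φ₂ P₁ P₂ hP₁ hP₂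
    hL₁ hL₂ t ht htT₁ htT₂ hguard x₀ R hagree χ hχ hsupp F hF hFb
  -- thresholds
  have hσ₁c : σ₁ < σc := hσ₁'.trans_le ((min_le_left _ _).trans (min_le_left _ _))
  have hσ₂c : σ₂ < σc := hσ₂'.trans_le ((min_le_left _ _).trans (min_le_left _ _))
  have hσ₁p : σ₁ < σp := hσ₁'.trans_le ((min_le_left _ _).trans (min_le_right _ _))
  have hσ₂p : σ₂ < σp := hσ₂'.trans_le ((min_le_left _ _).trans (min_le_right _ _))
  have hσ₂s : σ₂ < σs := hσ₂'.trans_le ((min_le_right _ _).trans (min_le_left _ _))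
  have hσ₁4 : σ₁ ≤ 1 / 4 := (hσ₁'.trans_le ((min_le_right _ _).trans (min_le_right _ _))).le
  have hσ₂4 : σ₂ ≤ 1 / 4 := (hσ₂'.trans_le ((min_le_right _ _).trans (min_le_right _ _))).le
  -- the commensurate particle number and a full family of flows extending `Φ₂` (Alexander)
  set nstar : ℕ → ℕ := fun N => ⌈(σ₂ / σ₁) ^ 3 * ((N + 1 : ℕ) : ℝ)⌉₊ with hnstar_def
  have hnstar : ∀ N, nstar N = ⌈(σ₂ / σ₁) ^ 3 * ((N + 1 : ℕ) : ℝ)⌉₊ := fun N => rfl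
  have hflow : ∀ N n, Nonempty (HardSphereFlow G3 (hsDiameter σ₁ N) n) := fun N n =>
    (show ∀ {ε : ℝ}, 0 < ε → ε < 2⁻¹ → ∀ n : ℕ, Nonempty (HardSphereFlow (Torus.geometry (Fin 3)) ε n) from
      HardSphereFlow.nonempty_torus_holds) (hsDiameter_pos hσ₁ N)
      ((hsDiameter_le hσ₁.le N).trans_lt (by linarith)) n
  let Ψ : (N n : ℕ) → HardSphereFlow G3 (hsDiameter σ₁ N) n := fun N n =>
    if h : n₂ N = n then h ▸ Φ₂ N else Classical.choice (hflow N n)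
  have hΨ : ∀ N, Ψ N (n₂ N) = Φ₂ N := fun N => by simp [Ψ]
  -- the `n₂*`-gas: probability laws and the `t = 0` tie
  have hPstar : ∀ N, IsProbabilityMeasure (particleLaw (Ψ N (nstar N))
      (canonicalDensity G3 (hsDiameter σ₁ N) (nstar N) (localGibbsProfile a₂ u₂ θ₂))) := fun N =>
    isProbabilityMeasure_commensurate ha₂ hθ₂ hu₂ ha₂0 hθ₂0 hσ₁ hσ₁4 hσ₂ hσ₂4 N (hnstar N) _
  have hnstar_t : Tendsto (fun N => (nstar N : ℝ) * hsDiameter σ₁ N ^ 3) atTop (𝓝 (σ₂ ^ 3)) :=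
    tendsto_ceil_mul_hsDiameter hσ₁ hσ₂ hnstar
  obtain ⟨ρa, _hρac, _hρa0, _hρa1, _hinv, Hstat⟩ := Hσs σ₂ hσ₂ hσ₂s
  have hε0 : ∀ N, 0 < hsDiameter σ₁ N := fun N => hsDiameter_pos hσ₁ N
  have hεt : Tendsto (fun N => hsDiameter σ₁ N) atTop (𝓝 0) := tendsto_hsDiameter σ₁
  have hA1 : LLNAt n₂ P₂ Φ₂ ρa u₂ θ₂ 0 :=
    fun χ' hχ' δ hδ => Hstat (fun N => hsDiameter σ₁ N) n₂ hε0 hεt hn₂ Φ₂ hP₂ χ' hχ' δ hδ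
  have hB : LLNAt nstar (fun N => particleLaw (Ψ N (nstar N))
      (canonicalDensity G3 (hsDiameter σ₁ N) (nstar N) (localGibbsProfile a₂ u₂ θ₂)))
      (fun N => Ψ N (nstar N)) ρa u₂ θ₂ 0 :=
    fun χ' hχ' δ hδ => Hstat (fun N => hsDiameter σ₁ N) nstar hε0 hεt hnstar_t (fun N => Ψ N (nstar N))
      hPstar χ' hχ' δ hδ
  have hLstar : LLNAt nstar (fun N => particleLaw (Ψ N (nstar N))
      (canonicalDensity G3 (hsDiameter σ₁ N) (nstar N) (localGibbsProfile a₂ u₂ θ₂)))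
      (fun N => Ψ N (nstar N)) (ρ₂ 0) (U₂ 0) (Θ₂ 0) 0 :=
    llnAt_transfer hP₂ hA1 (hL₂ : LLNAt n₂ P₂ Φ₂ (ρ₂ 0) (U₂ 0) (Θ₂ 0) 0) hB
  -- guards for the two stubs
  have hguard₁ : ∀ s ∈ Set.Icc 0 t, ∀ x, ρ₁ s x * σ₁ ^ 3 < η₁ ∧ Θ₁ s x ≤ M ∧ ‖U₁ s x‖ ≤ M ∧
      ρ₂ s x * σ₂ ^ 3 < η₁ ∧ Θ₂ s x ≤ M ∧ ‖U₂ s x‖ ≤ M := fun s hs x =>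
    ⟨(hguard s hs x).1.trans_le (min_le_left _ _), (hguard s hs x).2.1, (hguard s hs x).2.2.1,
      (hguard s hs x).2.2.2.1.trans_le (min_le_left _ _), (hguard s hs x).2.2.2.2.1,
      (hguard s hs x).2.2.2.2.2⟩
  have hguard₂ : ∀ s ∈ Set.Icc 0 t, ∀ x, ρ₂ s x * σ₂ ^ 3 < η₂ ∧ Θ₂ s x ≤ M ∧ ‖U₂ s x‖ ≤ M :=
    fun s hs x => ⟨(hguard s hs x).2.2.2.1.trans_le (min_le_right _ _), (hguard s hs x).2.2.2.2.1,
      (hguard s hs x).2.2.2.2.2⟩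
  -- (i) the cone: gas 1 vs the commensurate gas
  have h1 := Hσc σ₁ σ₂ hσ₁ hσ₁c hσ₂ hσ₂c nstar hnstar T₁ T₂ ρ₁ Θ₁ ρ₂ Θ₂ U₁ U₂ hsol₁ hsol₂ Φ₁
    (fun N => Ψ N (nstar N)) hP₁ hPstar hL₁ hLstar t ht htT₁ htT₂ hguard₁ x₀ R hagree χ hχ hsupp F hF hFb
  -- (ii) particle-number merging: the commensurate gas vs the given comparison gas
  have h2 := Hσp σ₁ σ₂ hσ₁ hσ₁p hσ₂ hσ₂p T₂ ρ₂ Θ₂ U₂ hsol₂ n₂ Φ₂ hn₂ hP₂ hL₂ Ψ t ht htT₂ hguard₂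
    nstar n₂ hnstar_t hn₂ χ hχ F hF hFb
  -- add
  have h3 := h1.add h2
  rw [add_zero] at h3
  refine h3.congr fun N => ?_
  beta_reduce
  rw [hΨ N]
  exact sub_add_sub_cancel _ _ _

/-- D-0027 §3.3 shape: the crux from the registered stubs — an `example`, so that `LightConeInLaw_of` stays the
unique theorem concluding the crux. -/
example : Summit.AtomisticToContinuum.HydrodynamicLimit.Theses.RelayRaceLocality.LightConeInLaw :=
  LightConeInLaw_of Holds.stub_cone Holds.stub_var

end

end Summit.AtomisticToContinuum.HydrodynamicLimit.Cruxes.LightConeInLaw.SusceptibilityVarianceContinuity
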